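/-
Copyright (c) 2026 the pub-hodgecm-mathlib formalisation cell (harness21).  Prover seat hodgecm-mathlib-K2Liu-p05 (g2), 2026-09-04
(Track B «K2-LIT», crux hLiu418 = stmt-HodgeConjecture-24832, organ (L24-a) of socket #24i∕#30i `sig_K2LiuThetaTypeSphericalEigenvalueInert`,
LEAD F0P6-plan (g11) RULING «M-155g» (ii); the §4 dock of the (L24-a) report).
-/
import Summits.HodgeConjecture.HodgeConjecture.Theorems.K2LiuInertWeilSphericalLineLocalInt   -- ★ (this seat): heads at `U(J)(𝒪_v)` from an integral hyperbolic frame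
import Summits.HodgeConjecture.HodgeConjecture.Theorems.K2LiuInertFrameInputs               -- ★ K2Liu-p01 (g4): `apply_hermForm_of_smul_eq`, `hermForm_formCongr_frameVec_left`
import HarnessLib

/-!
# (L24-a), the frame dock: the INTEGRAL HYPERBOLIC FRAME of `(V ⊗ W) ⊗ F_v` at an inert place from #28i∕#24i's frame block
# `T ∈ GL₂(𝒪_w)`, `J_{V,w} = σ(T)ᵀ · antidiag(1,1) · T`

Topic: crux hLiu418 (stmt-HodgeConjecture-24832), Track B «K2-LIT», socket #24i∕#30i `sig_K2LiuThetaTypeSphericalEigenvalueInert`, organ (L24-a)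
(LEAD F0P6-plan (g11) RULING «M-155g» (ii), GO 04:33:49Z (1) «§4 (dock from #24i's frame block) stays yours»).  Sequel of ★
`K2LiuInertWeilSphericalLineLocalInt` (the line `ω_v^{U(J)(𝒪_v)} = ℂ ∙ 1_{𝒪_vⁿ}` from an abstract integral hyperbolic frame `(y, ys)` of `E_vⁿ`).
Namespace `Summit.HodgeConjecture.HodgeConjecture.Cruxes.HLiu418.K2LiuInertWeilSphericalLine` (continued).  THEOREMS ONLY (no definition, no named
fact, no instance, no notation, no `sorry`); `--supports stmt-HodgeConjecture-24832 --as helper`; count-neutral.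

THE MATHEMATICS ([GelbartRogawski1991, §3.2 p. 457]; [Dieudonne1971GroupesClassiques, Chap. II §5]).  At a NON-SPLIT place `v` of `F` (`c • w = w`, so `w` is the
only place above `v` and `E_v = E ⊗_F F_v = E_w`, ★ `LocalRing.eq_iff_apply_eq`), let the rank-`2` form `J_V` have an integral hyperbolic frame at `w`:
`J_{V,w} = σ_w(T)ᵀ · antidiag(1,1) · T` with `T ∈ GL₂(𝒪_w)` (#28i∕#24i's binders `hTi`, `hTJ`; ★ K1⁺ `exists_glInt_placeForm_eq_formCongr_antidiagonal_of_isUnramifiedIn`),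
and let the line form `J_W` read `(a_w)` at `w` with `a_w` a `σ_w`-fixed `w`-UNIT.  On `S = (V ⊗ W) ⊗ F_v ≅ E_vⁿ` (`e : Fin 2 × Fin 1 ≃ Fin n`) with the form
`h = hermForm σ (J_V ⊗ J_W)_v` the LIFTS `y := ↑(T⁻¹e₀)`, `ys := ↑(a_w⁻¹ T⁻¹e₁)` (K2Liu-p01 (g4)'s (F2) frame of ★ `K2LiuInertFrameInputs`) satisfy:
`h(y,y) = h(ys,ys) = 0`, `h(ys,y) = h(y,ys) = 1` (★ `hermForm_formCongr_frameVec`, ★ `hermForm_reindex_kronecker_lift`), every coordinate of `y, ys` is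
integral at every `w' ∣ v` (`T⁻¹ ∈ GL₂(𝒪_w)`, `a_w⁻¹ ∈ 𝒪_w^×`), and the FRAME IDENTITY `x = h(ys, x) • y + h(y, x) • ys` for every `x ∈ E_vⁿ`
(`h(T⁻¹eᵢ, β) = (antidiag · Tβ)ᵢ`, ★ `hermForm_formCongr_frameVec_left`, and `β = T⁻¹(Tβ)`).  These are exactly the frame hypotheses of ★
`fixedPoints_omegaLoc_localInt_eq_span_unitVec_of_frame`; §12 assembles the #24i-binder heads: **`ω_v^{U(J_V ⊗ J_W)(𝒪_v)} = ℂ ∙ 1_{𝒪_vⁿ}`**, its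
pull-back along `localLineInl` to `U(J_V)(𝒪_v)`, and the θ-factor line bound — with NO frame binders left, only the place block (`w`, `hw`, `T`, `hTi`, `hTJ`),
the `W`-scalar block (`a_w` σ-fixed unit) and the cofinite side conditions (`2`, `δ`, `ψ_v`, `𝕋_v`, Ω1; ★ §7 of `…Frame`).

HONEST LABEL: HC_CM is proved only modulo the 7 printed citations (2 remaining named inputs: hLiu418 = stmt-HodgeConjecture-24832, h413 =
stmt-HodgeConjecture-24833) until rung 0 closes; count-neutral helper toward #24i, closes nothing.

## References
* [GelbartRogawski1991] S. Gelbart, J. Rogawski, Invent. Math. 105 (1991), §3.2 p. 457.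
* [Dieudonne1971GroupesClassiques] J. Dieudonné, *La géométrie des groupes classiques* (1971), Chap. II §5 (hyperbolic pairs).
* [MoeglinVignerasWaldspurger1987] C. Mœglin, M.-F. Vignéras, J.-L. Waldspurger, LNM 1291 (1987), Chap. 5 I.4, I.11.
* [PlatonovRapinchuk1994] V. Platonov, A. Rapinchuk, *Algebraic Groups and Number Theory* (1994), §5.1.
-/

set_option autoImplicit false
set_option linter.dupNamespace false

noncomputable section

open NumberField IsDedekindDomain
open scoped Matrix NNReal Kronecker
open Literature.RepresentationTheory.HeisenbergGroup
open Literature.NumberTheory.Automorphic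
open Literature.NumberTheory.Automorphic.UnitaryGroup
open Literature.NumberTheory.GelbartRogawski1991.UnitaryDualPair.LocalSplitting
open Literature.NumberTheory.GaloisRepresentations.IsNonarchimedeanLocalField
open Summit.HodgeConjecture.HodgeConjecture.Cruxes.HLiu418.K2LiuHyperbolicFrameVectors
open Summit.HodgeConjecture.HodgeConjecture.Cruxes.HLiu418.K2LiuInertFrameInputs

namespace Summit.HodgeConjecture.HodgeConjecture.Cruxes.HLiu418.K2LiuInertWeilSphericalLine

/-! ## §11 The lifted frame `(↑T⁻¹e₀, ↑a⁻¹T⁻¹e₁)` of `E_vⁿ` at an inert place -/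

section FrameDock

variable {F : Type} [Field F] [NumberField F] (E : Type) [Field E] [NumberField E] [Algebra F E]
  [Algebra.IsQuadraticExtension F E] (c : E ≃ₐ[F] E) (hc : c ≠ 1) {n : ℕ} (e : Fin 2 × Fin 1 ≃ Fin n)
  (JV : Matrix (Fin 2) (Fin 2) E) (JW : Matrix (Fin 1) (Fin 1) E)
  (v : HeightOneSpectrum (𝓞 F)) (w : PlacesOver E v) (hw : c • w.1 = w.1)

omit [NumberField F] [Algebra.IsQuadraticExtension F E] in
/-- `(antidiag(1,1) · u)₀ = u₁`. [cite: Dieudonne1971GroupesClassiques, Chap. II §5] -/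
theorem antidiagonal_two_mulVec_zero {K : Type*} [CommRing K] (u : Fin 2 → K) :
    ((StdForm.antidiagonal 2).over K *ᵥ u) 0 = u 1 := by
  rw [Matrix.mulVec, dotProduct, Fin.sum_univ_two, StdForm.antidiagonal_over_apply, StdForm.antidiagonal_over_apply,
    if_neg (by decide), if_pos (by decide), zero_mul, zero_add, one_mul]

omit [NumberField F] [Algebra.IsQuadraticExtension F E] in
/-- `(antidiag(1,1) · u)₁ = u₀`. [cite: Dieudonne1971GroupesClassiques, Chap. II §5] -/
theorem antidiagonal_two_mulVec_one {K : Type*} [CommRing K] (u : Fin 2 → K) :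
    ((StdForm.antidiagonal 2).over K *ᵥ u) 1 = u 0 := by
  rw [Matrix.mulVec, dotProduct, Fin.sum_univ_two, StdForm.antidiagonal_over_apply, StdForm.antidiagonal_over_apply,
    if_pos (by decide), if_neg (by decide), one_mul, zero_mul, add_zero]

include hc hw in
/-- **THE LIFTED INTEGRAL HYPERBOLIC FRAME AT AN INERT PLACE.**  Let `v` be non-split (`c • w = w`), `J_{W,w} = (a_w)` with `a_w` a `σ_w`-fixed `w`-unit, and
`J_{V,w} = σ_w(T)ᵀ · antidiag(1,1) · T` with `T ∈ GL₂(𝒪_w)`.  Then `E_vⁿ ≅ (V ⊗ W)_v` (`e : Fin 2 × Fin 1 ≃ Fin n`) carries vectors `y, ys` — the lifts of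
`T⁻¹e₀` and `a_w⁻¹ T⁻¹e₁` — with, for `h = hermForm σ (J_V ⊗ J_W)_v`: `h(y,y) = h(ys,ys) = 0`, `h(ys,y) = h(y,ys) = 1`, all coordinates integral at every `w' ∣ v`,
and the frame identity `x = h(ys,x) • y + h(y,x) • ys` for every `x` — the frame hypotheses of ★ `fixedPoints_omegaLoc_localInt_eq_span_unitVec_of_frame`.
[cite: GelbartRogawski1991, §3.2 p. 457] [cite: Dieudonne1971GroupesClassiques, Chap. II §5] -/
theorem exists_integralHyperbolicFrame_of_formCongr
    (aw : w.1.adicCompletion E) (hJW : UnitaryGroup.placeForm JW w.1 = Matrix.of fun _ _ : Fin 1 => aw)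
    (hσa : galAdicCompletionMap (L := E) c hw aw = aw) (hau : Valued.v aw = 1)
    (T : GL (Fin 2) (w.1.adicCompletion E)) (hTi : T ∈ glInt 2 (w.1.adicCompletion E))
    (hTJ : UnitaryGroup.placeForm JV w.1 =
      formCongr (galAdicCompletionMap (L := E) c hw) T ((StdForm.antidiagonal 2).over (w.1.adicCompletion E))) :
    ∃ y ys : Fin n → LocalRing E v,
      hermForm (conjLocal E c v) ((adelicForm E n (Matrix.reindex e e (JV ⊗ₖ JW))).map (adeleToLocal E v)) y y = 0 ∧
      hermForm (conjLocal E c v) ((adelicForm E n (Matrix.reindex e e (JV ⊗ₖ JW))).map (adeleToLocal E v)) ys ys = 0 ∧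
      hermForm (conjLocal E c v) ((adelicForm E n (Matrix.reindex e e (JV ⊗ₖ JW))).map (adeleToLocal E v)) ys y = 1 ∧
      hermForm (conjLocal E c v) ((adelicForm E n (Matrix.reindex e e (JV ⊗ₖ JW))).map (adeleToLocal E v)) y ys = 1 ∧
      (∀ (j : Fin n) (w' : PlacesOver E v), y j w' ∈ w'.1.adicCompletionIntegers E) ∧
      (∀ (j : Fin n) (w' : PlacesOver E v), ys j w' ∈ w'.1.adicCompletionIntegers E) ∧
      ∀ x : Fin n → LocalRing E v,
        x = hermForm (conjLocal E c v) ((adelicForm E n (Matrix.reindex e e (JV ⊗ₖ JW))).map (adeleToLocal E v)) ys x • y +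
          hermForm (conjLocal E c v) ((adelicForm E n (Matrix.reindex e e (JV ⊗ₖ JW))).map (adeleToLocal E v)) y x • ys := by
  classical
  -- notation: the involution and frame at `w`, the antidiagonal form, the lift `↑z` of a `w`-vector `z : Fin 2 → E_w` to `E_vⁿ`
  set σ : w.1.adicCompletion E →+* w.1.adicCompletion E := galAdicCompletionMap (L := E) c hw with hσdef
  set A : Matrix (Fin 2) (Fin 2) (w.1.adicCompletion E) := (StdForm.antidiagonal 2).over (w.1.adicCompletion E) with hAdef
  set H : Matrix (Fin 2) (Fin 2) (w.1.adicCompletion E) := formCongr σ T A with hHdef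
  set y₀ : Fin 2 → w.1.adicCompletion E :=
    ((T⁻¹ : GL (Fin 2) (w.1.adicCompletion E)) : Matrix (Fin 2) (Fin 2) (w.1.adicCompletion E)) *ᵥ Pi.single 0 1 with hy₀
  set y₁ : Fin 2 → w.1.adicCompletion E :=
    ((T⁻¹ : GL (Fin 2) (w.1.adicCompletion E)) : Matrix (Fin 2) (Fin 2) (w.1.adicCompletion E)) *ᵥ Pi.single 1 1 with hy₁
  let up : (Fin 2 → w.1.adicCompletion E) → (Fin n → LocalRing E v) := fun z b =>
    Pi.single (M := fun w' : PlacesOver E v => w'.1.adicCompletion E) w (z (e.symm b).1)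
  have hup : ∀ z b, up z b w = z (e.symm b).1 := fun z b =>
    Pi.single_eq_same (M := fun w' : PlacesOver E v => w'.1.adicCompletion E) w _
  have hupw : ∀ z, (fun b => up z b w) = fun b => z (e.symm b).1 := fun z => funext (hup z)
  -- the Gram matrix of `h` read at `w`
  have hG : (((adelicForm E n (Matrix.reindex e e (JV ⊗ₖ JW))).map (adeleToLocal E v)).map
      (Pi.evalRingHom (fun w' : PlacesOver E v => w'.1.adicCompletion E) w)) =
      Matrix.reindex e e (H ⊗ₖ (Matrix.of fun _ _ : Fin 1 => aw)) := by
    rw [localForm_map_eval, placeForm_reindex_kronecker, hTJ, hJW]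
  -- `h(↑z, ↑z')_w = a_w · hermForm σ H z z'` and `h(↑z, x)_w = a_w · hermForm σ H z β_x`
  have hform : ∀ z z' : Fin 2 → w.1.adicCompletion E,
      hermForm (conjLocal E c v) ((adelicForm E n (Matrix.reindex e e (JV ⊗ₖ JW))).map (adeleToLocal E v)) (up z) (up z') w =
        aw * hermForm σ H z z' := by
    intro z z'
    rw [apply_hermForm_of_smul_eq c v w hc hw, hG, hupw, hupw, hermForm_reindex_kronecker_lift]
  have hformx : ∀ (z : Fin 2 → w.1.adicCompletion E) (x : Fin n → LocalRing E v),
      hermForm (conjLocal E c v) ((adelicForm E n (Matrix.reindex e e (JV ⊗ₖ JW))).map (adeleToLocal E v)) (up z) x w =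
        aw * hermForm σ H z (fun i => x (e (i, 0)) w) := by
    intro z x
    have hx : (fun b => x b w) = fun b => x (e ((e.symm b).1, 0)) w := by
      funext b
      have h2 : ((e.symm b).1, (0 : Fin 1)) = e.symm b := Prod.ext rfl (Subsingleton.elim _ _)
      rw [h2, Equiv.apply_symm_apply]
    rw [apply_hermForm_of_smul_eq c v w hc hw, hG, hupw, hx, hermForm_reindex_kronecker_lift σ e H aw z (fun i => x (e (i, 0)) w)]
  -- values of `hermForm σ H` on the frame
  have hA00 : hermForm σ H y₀ y₀ = 0 := by
    rw [hHdef, hy₀, hermForm_formCongr_frameVec, hAdef, StdForm.antidiagonal_over_apply]; exact if_neg (by decide)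
  have hA11 : hermForm σ H y₁ y₁ = 0 := by
    rw [hHdef, hy₁, hermForm_formCongr_frameVec, hAdef, StdForm.antidiagonal_over_apply]; exact if_neg (by decide)
  have hA10 : hermForm σ H y₁ y₀ = 1 := by
    rw [hHdef, hy₁, hy₀, hermForm_formCongr_frameVec, hAdef, StdForm.antidiagonal_over_apply]; exact if_pos (by decide)
  have hA01 : hermForm σ H y₀ y₁ = 1 := by
    rw [hHdef, hy₀, hy₁, hermForm_formCongr_frameVec, hAdef, StdForm.antidiagonal_over_apply]; exact if_pos (by decide)
  have hau0 : aw ≠ 0 := fun h0 => by rw [h0, map_zero] at hau; exact zero_ne_one hau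
  have hσa' : σ aw⁻¹ = aw⁻¹ := by rw [map_inv₀, hσa]
  -- equality in `E_v` is equality at `w`
  have heq : ∀ s t : LocalRing E v, s w = t w → s = t := fun s t h => (LocalRing.eq_iff_apply_eq c hc w hw s t).2 h
  -- `𝒪[E_w]` of ★ `glInt` is the valuation ring of the `ValuativeRel` valuation; convert to `Valued.v`
  have toV : ∀ t : w.1.adicCompletion E, ValuativeRel.valuation (w.1.adicCompletion E) t ≤ 1 → Valued.v t ≤ 1 := fun t ht => by
    have h := (valuation_le_valuation_iff_valued (K := E) w.1 t 1).1 (by rw [map_one]; exact ht)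
    rwa [map_one] at h
  refine ⟨up y₀, up (aw⁻¹ • y₁), ?_, ?_, ?_, ?_, ?_, ?_, ?_⟩
  · exact heq _ _ (by rw [hform, hA00, mul_zero]; rfl)
  · refine heq _ _ ?_
    rw [hform, hermForm_smul_left_eq, hermForm_smul_right, hA11, mul_zero, mul_zero, mul_zero]; rfl
  · refine heq _ _ ?_
    rw [hform, hermForm_smul_left_eq, hσa', hA10, mul_one, mul_inv_cancel₀ hau0]; rfl
  · refine heq _ _ ?_
    rw [hform, hermForm_smul_right, hA01, mul_one, mul_inv_cancel₀ hau0]; rfl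
  · -- integrality of `↑T⁻¹e₀`
    intro j w'
    rw [PlacesOver.eq_of_smul_eq c hc w hw w', hup, hy₀, Matrix.mulVec_single_one, Matrix.col_apply,
      HeightOneSpectrum.mem_adicCompletionIntegers]
    have hint := ((mem_glInt_iff _).1 hTi).2 ((e.symm j).1) 0
    rw [Valuation.mem_integer_iff] at hint
    exact toV _ hint
  · -- integrality of `↑a⁻¹T⁻¹e₁`
    intro j w'
    rw [PlacesOver.eq_of_smul_eq c hc w hw w', hup, Pi.smul_apply, smul_eq_mul, hy₁, Matrix.mulVec_single_one, Matrix.col_apply,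
      HeightOneSpectrum.mem_adicCompletionIntegers, map_mul, map_inv₀, hau, inv_one, one_mul]
    have hint := ((mem_glInt_iff _).1 hTi).2 ((e.symm j).1) 1
    rw [Valuation.mem_integer_iff] at hint
    exact toV _ hint
  · -- the frame identity, checked coordinatewise at `w`
    intro x
    funext b
    refine heq _ _ ?_
    rw [Pi.add_apply, Pi.smul_apply, Pi.smul_apply, smul_eq_mul, smul_eq_mul, Pi.add_apply, Pi.mul_apply, Pi.mul_apply, hformx, hformx,
      hup, hup, hermForm_smul_left_eq, hσa', Pi.smul_apply, smul_eq_mul]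
    -- `h(T⁻¹eᵢ, β) = (A (Tβ))ᵢ`
    rw [hHdef, hy₁, hy₀, hermForm_formCongr_frameVec_left, hermForm_formCongr_frameVec_left, hAdef, antidiagonal_two_mulVec_one,
      antidiagonal_two_mulVec_zero, Matrix.mulVec_single_one, Matrix.mulVec_single_one, Matrix.col_apply, Matrix.col_apply]
    -- `β = T⁻¹ (T β)` at the coordinate `i = (e⁻¹ b).1`
    have hββ : (fun i => x (e (i, 0)) w) = ((T⁻¹ : GL (Fin 2) (w.1.adicCompletion E)) : Matrix (Fin 2) (Fin 2) (w.1.adicCompletion E)) *ᵥ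
        ((T : Matrix (Fin 2) (Fin 2) (w.1.adicCompletion E)) *ᵥ fun i => x (e (i, 0)) w) := by
      rw [Matrix.mulVec_mulVec, ← Units.val_mul, inv_mul_cancel, Units.val_one, Matrix.one_mulVec]
    have hb : x b w = (fun i => x (e (i, 0)) w) (e.symm b).1 := by
      have h2 : ((e.symm b).1, (0 : Fin 1)) = e.symm b := Prod.ext rfl (Subsingleton.elim _ _)
      simp only [h2, Equiv.apply_symm_apply]
    rw [hb]
    conv_lhs => rw [hββ]
    rw [Matrix.mulVec, dotProduct, Fin.sum_univ_two]
    field_simp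

end FrameDock

/-! ## §12 The #24i-binder heads: `ω_v^{U(J_V ⊗ J_W)(𝒪_v)} = ℂ ∙ 1_{𝒪_vⁿ}` and its pull-back to `U(J_V)(𝒪_v)` at an inert place with an
integral hyperbolic frame -/

section Heads

variable {F : Type} [Field F] [NumberField F] (E : Type) [Field E] [NumberField E] [Algebra F E]
  [Algebra.IsQuadraticExtension F E] (c : E ≃ₐ[F] E) (hc : c ≠ 1) {n : ℕ} (e : Fin 2 × Fin 1 ≃ Fin n)
  (JV : Matrix (Fin 2) (Fin 2) E) (JW : Matrix (Fin 1) (Fin 1) E) (hJW0 : JW 0 0 ≠ 0)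
  {δ : E} (hcδ : c δ = -δ) (hδ : δ ≠ 0) {d : F} (hd : δ * δ = algebraMap F E d) (T₀ : Matrix (Fin n) (Fin n) F) (hT₀ : T₀.IsSymm)
  (hJ : Matrix.reindex e e (JV ⊗ₖ JW) = T₀.map (algebraMap F E)) (hJh : ((Matrix.reindex e e (JV ⊗ₖ JW)).map c)ᵀ = Matrix.reindex e e (JV ⊗ₖ JW))
  (v : HeightOneSpectrum (𝓞 F)) (w : PlacesOver E v) (hw : c • w.1 = w.1)

include hc hw hJh in
/-- **(L24-a) WITH #24i's BINDERS: `ω_v^{U(J_V ⊗ J_W)(𝒪_v)} = ℂ ∙ 1_{𝒪_vⁿ}` at an inert place with an integral hyperbolic frame.**  For a family `𝓢` of local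
splittings of `U(J_V ⊗ J_W)(F_v)` over `ι_v` (`det T₀` a unit), at a non-split `v` (`c • w = w`) where `2` is a `v`-unit, `δ` a `w`-unit, `ψ_v` has conductor
`𝒪_v`, `𝕋₀_v` is `v`-integral and `U(𝒪_v)` fixes `1_{𝒪_vⁿ}` (all cofinite), with `J_{W,w} = (a_w)` (`a_w` a `σ_w`-fixed `w`-unit) and `J_{V,w} = σ_w(T)ᵀ antidiag T`,
`T ∈ GL₂(𝒪_w)`: the `U(J_V ⊗ J_W)(𝒪_v)`-fixed vectors of `ω_v` are `ℂ ∙ 1_{𝒪_vⁿ}` (§11 frame + ★ `fixedPoints_omegaLoc_localInt_eq_span_unitVec_of_frame`).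
[cite: MoeglinVignerasWaldspurger1987, Chap. 5 I.4, I.11] [cite: GelbartRogawski1991, §3.2 p. 457] -/
theorem fixedPoints_omegaLoc_localInt_eq_span_unitVec_inert (𝓢 : FinLocalSplittings F E c n hcδ hδ hd T₀ hT₀ hJ) (hT₀d : IsUnit T₀.det)
    (h2 : Valued.v (2 : v.adicCompletion F) = 1) (hδu : ∀ w' : PlacesOver E v, Valued.v (algebraMap E (LocalRing E v) δ w') = 1)
    (hcond : (adeleAddCharAt F v).HasConductorExp 0) (hTi : ∀ i j, localGram F n T₀ v i j ∈ primePowBall (v.adicCompletion F) 0)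
    (hunr : unitVec F (Fin n) v ∈ (𝓢.omegaLoc v).fixedPoints (localInt E c n (Matrix.reindex e e (JV ⊗ₖ JW)) v))
    (aw : w.1.adicCompletion E) (hJW : UnitaryGroup.placeForm JW w.1 = Matrix.of fun _ _ : Fin 1 => aw)
    (hσa : galAdicCompletionMap (L := E) c hw aw = aw) (hau : Valued.v aw = 1)
    (T : GL (Fin 2) (w.1.adicCompletion E)) (hTi' : T ∈ glInt 2 (w.1.adicCompletion E))
    (hTJ : UnitaryGroup.placeForm JV w.1 =
      formCongr (galAdicCompletionMap (L := E) c hw) T ((StdForm.antidiagonal 2).over (w.1.adicCompletion E))) :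
    (𝓢.omegaLoc v).fixedPoints (localInt E c n (Matrix.reindex e e (JV ⊗ₖ JW)) v) = ℂ ∙ unitVec F (Fin n) v := by
  obtain ⟨y, ys, hy, hys, -, -, hyi, hysi, hframe⟩ :=
    exists_integralHyperbolicFrame_of_formCongr E c hc e JV JW v w hw aw hJW hσa hau T hTi' hTJ
  exact fixedPoints_omegaLoc_localInt_eq_span_unitVec_of_frame E c n hcδ hδ hd T₀ hT₀ hJ hJh v 𝓢 hT₀d w (PlacesOver.eq_of_smul_eq c hc w hw) h2
    hδu hcond hTi hunr hy hys hyi hysi hframe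

include hc hw hJh hJW0 in
/-- **… pulled back to `U(J_V)(𝒪_v)` along `localLineInl`** (`J_W 0 0 ≠ 0`): the `U(J_V)(𝒪_v)`-fixed vectors of `ω_v ∘ localLineInl v` are `ℂ ∙ 1_{𝒪_vⁿ}` — the
`hline` of the inert Hecke computation (L24-b), with #24i's binders. [cite: MoeglinVignerasWaldspurger1987, Chap. 5 I.11] [cite: Liu2021, Def. 4.11 (l. 2092–2096)] -/
theorem fixedPoints_omegaLoc_comp_localLineInl_localInt_eq_span_unitVec_inert (𝓢 : FinLocalSplittings F E c n hcδ hδ hd T₀ hT₀ hJ)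
    (hT₀d : IsUnit T₀.det) (h2 : Valued.v (2 : v.adicCompletion F) = 1)
    (hδu : ∀ w' : PlacesOver E v, Valued.v (algebraMap E (LocalRing E v) δ w') = 1)
    (hcond : (adeleAddCharAt F v).HasConductorExp 0) (hTi : ∀ i j, localGram F n T₀ v i j ∈ primePowBall (v.adicCompletion F) 0)
    (hunr : unitVec F (Fin n) v ∈ (𝓢.omegaLoc v).fixedPoints (localInt E c n (Matrix.reindex e e (JV ⊗ₖ JW)) v))
    (aw : w.1.adicCompletion E) (hJW : UnitaryGroup.placeForm JW w.1 = Matrix.of fun _ _ : Fin 1 => aw)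
    (hσa : galAdicCompletionMap (L := E) c hw aw = aw) (hau : Valued.v aw = 1)
    (T : GL (Fin 2) (w.1.adicCompletion E)) (hTi' : T ∈ glInt 2 (w.1.adicCompletion E))
    (hTJ : UnitaryGroup.placeForm JV w.1 =
      formCongr (galAdicCompletionMap (L := E) c hw) T ((StdForm.antidiagonal 2).over (w.1.adicCompletion E))) :
    Representation.fixedPoints ((𝓢.omegaLoc v).comp (localLineInl E c 2 e JV JW v)) (localInt E c 2 JV v) = ℂ ∙ unitVec F (Fin n) v := by
  obtain ⟨y, ys, hy, hys, -, -, hyi, hysi, hframe⟩ :=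
    exists_integralHyperbolicFrame_of_formCongr E c hc e JV JW v w hw aw hJW hσa hau T hTi' hTJ
  exact fixedPoints_omegaLoc_comp_localLineInl_localInt_eq_span_unitVec_of_frame E c 2 e JV JW hJW0 hcδ hδ hd T₀ hT₀ hJ hJh v 𝓢 hT₀d w
    (PlacesOver.eq_of_smul_eq c hc w hw) h2 hδu hcond hTi hunr hy hys hyi hysi hframe

include hc hw hJh hJW0 in
/-- **… and for the local θ-factor on `U(J_V)(F_v)`**: under the same hypotheses, for every `ρW` commuting with `ω_v` and every character `χ`, the
`U(J_V)(𝒪_v)`-fixed vectors of `(TwistedCoinv.rep χ ω_v _) ∘ localLineInl v` lie on `ℂ ∙ [1_{𝒪_vⁿ}]` — the S4c-H local factor line (L24-c) feeds to ★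
`IsHyperspecialAt.heckeOperator_inclPlace_apply_eq_smul`, with #24i's binders. [cite: Liu2021, App. D Lem. D.1 (l. 5226–5233)] [cite: MoeglinVignerasWaldspurger1987, Chap. 5 I.11] -/
theorem fixedPoints_twistedCoinv_omegaLoc_comp_localLineInl_le_span_inert (𝓢 : FinLocalSplittings F E c n hcδ hδ hd T₀ hT₀ hJ)
    (hT₀d : IsUnit T₀.det) (h2 : Valued.v (2 : v.adicCompletion F) = 1)
    (hδu : ∀ w' : PlacesOver E v, Valued.v (algebraMap E (LocalRing E v) δ w') = 1)
    (hcond : (adeleAddCharAt F v).HasConductorExp 0) (hTi : ∀ i j, localGram F n T₀ v i j ∈ primePowBall (v.adicCompletion F) 0)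
    (hunr : unitVec F (Fin n) v ∈ (𝓢.omegaLoc v).fixedPoints (localInt E c n (Matrix.reindex e e (JV ⊗ₖ JW)) v))
    (aw : w.1.adicCompletion E) (hJW : UnitaryGroup.placeForm JW w.1 = Matrix.of fun _ _ : Fin 1 => aw)
    (hσa : galAdicCompletionMap (L := E) c hw aw = aw) (hau : Valued.v aw = 1)
    (T : GL (Fin 2) (w.1.adicCompletion E)) (hTi' : T ∈ glInt 2 (w.1.adicCompletion E))
    (hTJ : UnitaryGroup.placeForm JV w.1 =
      formCongr (galAdicCompletionMap (L := E) c hw) T ((StdForm.antidiagonal 2).over (w.1.adicCompletion E)))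
    {H : Type*} [Group H] {ρW : Representation ℂ H (SchwartzBruhat (Fin n → v.adicCompletion F))} (χ : H →* ℂˣ)
    (hcomm : ∀ (g : UnitaryGroup.localPi E c n (Matrix.reindex e e (JV ⊗ₖ JW)) v) (h : H), Commute (𝓢.omegaLoc v g) (ρW h)) :
    Representation.fixedPoints
        ((Literature.RepresentationTheory.TwistedCoinv.rep χ (𝓢.omegaLoc v) hcomm).comp (localLineInl E c 2 e JV JW v))
        (localInt E c 2 JV v) ≤
      ℂ ∙ Literature.RepresentationTheory.TwistedCoinv.mk ρW χ (unitVec F (Fin n) v) := by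
  obtain ⟨y, ys, hy, hys, -, -, hyi, hysi, hframe⟩ :=
    exists_integralHyperbolicFrame_of_formCongr E c hc e JV JW v w hw aw hJW hσa hau T hTi' hTJ
  exact fixedPoints_twistedCoinv_omegaLoc_comp_localLineInl_le_span_of_frame E c 2 e JV JW hJW0 hcδ hδ hd T₀ hT₀ hJ hJh v 𝓢 hT₀d w
    (PlacesOver.eq_of_smul_eq c hc w hw) h2 hδu hcond hTi hunr hy hys hyi hysi hframe χ hcomm

end Heads

end Summit.HodgeConjecture.HodgeConjecture.Cruxes.HLiu418.K2LiuInertWeilSphericalLine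

end
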